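import Summits.KontsevichZagierPeriods.KontsevichZagierPeriods.Theorems.HurwitzMicroSectorsNormalFormPrincipleDilogExistsBoxAtoms

/-!
# `NormalFormPrinciple` (stmt-KontsevichZagierPeriods-3869), line `SketchIdeator1` —
# leaf `stub_boxRigidity`, dilogarithm layer: the box is a simplex piece (rule 2)

Pure proof file (registered sub-goal `box_sub_simplex` of the layer `Dilog`, lead seat c9;
`--supports` the crux). The dilogarithm box `D(a) = [□, 1/(a − x₀x₁)]` on the open unit box
`□ = (0,1)² ⊆ ℝ²` (value `Li₂(1/a)`) becomes the simplex piece
`A(z) = [{0 < t₁ < t₀ < z}, 1/(t₀(1 − t₁))]`, `z = 1/a`, by ONE change of variables of the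
Kontsevich–Zagier calculus (rule (2), `KZ.changeOfVariablesRel`): the merge–scale chart

  `Φ(x₀, x₁) = (z x₀, z x₀ x₁)`,  `DΦ(x) = !![z, 0; z x₁, z x₀]`,  `|det DΦ(x)| = z² x₀ > 0` on `□`,

with inverse `x₀ = t₀/z`, `x₁ = t₁/t₀`. For `a ≥ 1` (`0 < z ≤ 1`) the image `Φ '' □` is
`{0 < t₁ < t₀ < z}`; for `a < 0` (`z = w = 1/a < 0`) it is `{w < t₀ < t₁ < 0}`. The pull-back
identity on `□` reads `1/((z x₀)(1 − z x₀x₁)) · z² x₀ = z/(1 − z x₀x₁) = 1/(a − x₀x₁)` (using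
`a z = 1`). Each coordinate of `Φ` is the real-algebraic constant `z = a⁻¹` times a `ℚ`-monomial,
so `Φ` is a `ℚ`-semialgebraic map on `□` (`isSemialgebraicFunOn_const_of_isAlgebraic`,
`IsSemialgebraicMapOn.of_forall`); this is where the algebraicity of `a` enters. Pattern of
`AlgLevelTwo.lt2_exists_squaresChart` / `levelTwo_squares` (seat c8).

References: M. Kontsevich, D. Zagier, *Periods* (2001), §1.1–1.2, rule (2). No definitions are
introduced.
-/

noncomputable section

open MeasureTheory Set
open Literature.NumberTheory.Transcendental Literature.NumberTheory.Transcendental.KZ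
open Literature.ModelTheory.ExponentialFields (IsSemialgebraic)

namespace Summit.KontsevichZagierPeriods.HurwitzMicroSectors.NormalFormPrinciple.PiBox.Dilog

/-! ## The merge–scale chart -/

/-- **The merge–scale chart `Φ(x₀,x₁) = (s x₀, s x₀ x₁)`** for a non-zero real-algebraic factor
`s`: a `ℚ`-semialgebraic map on the open unit box (each coordinate is the algebraic constant `s`
times a `ℚ`-monomial), differentiable with derivative `!![s, 0; s x₁, s x₀]` and
`|det DΦ| = s² x₀` on the box, and injective on the box (`s ≠ 0`, `x₀ ≠ 0`). [folklore] -/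
theorem bss_exists_mergeScaleChart {s : ℝ} (hs : IsAlgebraic ℚ s) (hs0 : s ≠ 0) :
    ∃ (Φ : (Fin 2 → ℝ) → (Fin 2 → ℝ)) (Φ' : (Fin 2 → ℝ) → (Fin 2 → ℝ) →L[ℝ] (Fin 2 → ℝ)),
      (∀ x, Φ x 0 = s * x 0) ∧ (∀ x, Φ x 1 = s * x 0 * x 1) ∧
      IsSemialgebraicMapOn ℚ {x : Fin 2 → ℝ | ∀ i, x i ∈ Set.Ioo (0:ℝ) 1} Φ ∧
      (∀ x, HasFDerivAt Φ (Φ' x) x) ∧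
      Set.InjOn Φ {x : Fin 2 → ℝ | ∀ i, x i ∈ Set.Ioo (0:ℝ) 1} ∧
      (∀ x ∈ {x : Fin 2 → ℝ | ∀ i, x i ∈ Set.Ioo (0:ℝ) 1}, |(Φ' x).det| = s ^ 2 * x 0) := by
  set Φ : (Fin 2 → ℝ) → (Fin 2 → ℝ) := fun x => ![s * x 0, s * x 0 * x 1]
  set Φ' : (Fin 2 → ℝ) → (Fin 2 → ℝ) →L[ℝ] (Fin 2 → ℝ) :=
    fun x => LinearMap.toContinuousLinearMap (Matrix.toLin' !![s, 0; s * x 1, s * x 0])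
  have hΦ0 : ∀ x, Φ x 0 = s * x 0 := fun x => rfl
  have hΦ1 : ∀ x, Φ x 1 = s * x 0 * x 1 := fun x => rfl
  have hΦ'0 : ∀ x v : Fin 2 → ℝ, Φ' x v 0 = s * v 0 := by
    intro x v
    change Matrix.toLin' !![s, 0; s * x 1, s * x 0] v 0 = _
    rw [Matrix.toLin'_apply]
    simp [Matrix.mulVec, dotProduct, Fin.sum_univ_two]
  have hΦ'1 : ∀ x v : Fin 2 → ℝ, Φ' x v 1 = s * x 1 * v 0 + s * x 0 * v 1 := by
    intro x v
    change Matrix.toLin' !![s, 0; s * x 1, s * x 0] v 1 = _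
    rw [Matrix.toLin'_apply]
    simp [Matrix.mulVec, dotProduct, Fin.sum_univ_two]
  have hdet : ∀ x, (Φ' x).det = s ^ 2 * x 0 := by
    intro x
    change LinearMap.det (Matrix.toLin' !![s, 0; s * x 1, s * x 0]) = _
    rw [LinearMap.det_toLin', Matrix.det_fin_two_of]
    ring
  have hderiv : ∀ x, HasFDerivAt Φ (Φ' x) x := by
    intro x
    have h0 : HasFDerivAt (fun y : Fin 2 → ℝ => y 0)
        (ContinuousLinearMap.proj (R := ℝ) (φ := fun _ : Fin 2 => ℝ) 0) x := hasFDerivAt_apply 0 x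
    have h1 : HasFDerivAt (fun y : Fin 2 → ℝ => y 1)
        (ContinuousLinearMap.proj (R := ℝ) (φ := fun _ : Fin 2 => ℝ) 1) x := hasFDerivAt_apply 1 x
    rw [hasFDerivAt_pi']
    refine Fin.forall_fin_two.mpr ⟨?_, ?_⟩
    · have hf : (fun y : Fin 2 → ℝ => Φ y 0) = fun y => s * y 0 := funext fun y => by rw [hΦ0]
      rw [hf]
      refine (h0.const_mul s).congr_fderiv (ContinuousLinearMap.ext fun v => ?_)
      simp [hΦ'0]
    · have hf : (fun y : Fin 2 → ℝ => Φ y 1) = fun y => s * (y 0 * y 1) :=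
        funext fun y => by rw [hΦ1, mul_assoc]
      rw [hf]
      refine ((h0.mul h1).const_mul s).congr_fderiv (ContinuousLinearMap.ext fun v => ?_)
      simp [hΦ'1]
      ring
  refine ⟨Φ, Φ', hΦ0, hΦ1, ?_, hderiv, ?_, fun x hx => ?_⟩
  · -- each coordinate is the algebraic constant `s` times a `ℚ`-monomial
    have hB := isSemialgebraic_box 2
    have hc := isSemialgebraicFunOn_const_of_isAlgebraic hB hs
    refine IsSemialgebraicMapOn.of_forall hB (Fin.forall_fin_two.mpr ⟨?_, ?_⟩)
    · exact (IsSemialgebraicFunOn.mul_holds hc (isSemialgebraicFunOn_apply hB 0)).congr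
        fun _ _ => rfl
    · exact (IsSemialgebraicFunOn.mul_holds
        (IsSemialgebraicFunOn.mul_holds hc (isSemialgebraicFunOn_apply hB 0))
        (isSemialgebraicFunOn_apply hB 1)).congr fun _ _ => rfl
  · -- injective on the box (`s ≠ 0` and `x₀ ≠ 0` there)
    intro x hx y hy hxy
    have e0 : s * x 0 = s * y 0 := by rw [← hΦ0, ← hΦ0, hxy]
    have e1 : s * x 0 * x 1 = s * y 0 * y 1 := by rw [← hΦ1, ← hΦ1, hxy]
    have h0 : x 0 = y 0 := mul_left_cancel₀ hs0 e0
    rw [h0] at e1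
    have h1 : x 1 = y 1 := mul_left_cancel₀ (mul_ne_zero hs0 (hy 0).1.ne') e1
    funext i
    fin_cases i
    · exact h0
    · exact h1
  · -- the Jacobian
    rw [hdet, abs_of_pos (mul_pos (sq_pos_of_ne_zero hs0) (hx 0).1)]

/-- For `s > 0` the merge–scale chart maps the open unit box ONTO the open simplex piece
`{0 < t₁ < t₀ < s}` (inverse `t ↦ (t₀/s, t₁/t₀)`). [folklore] -/
theorem bss_image_box_of_pos {s : ℝ} (hs : 0 < s) {Φ : (Fin 2 → ℝ) → (Fin 2 → ℝ)}
    (hΦ0 : ∀ x, Φ x 0 = s * x 0) (hΦ1 : ∀ x, Φ x 1 = s * x 0 * x 1) :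
    Φ '' {x : Fin 2 → ℝ | ∀ i, x i ∈ Set.Ioo (0:ℝ) 1} = {t | 0 < t 1 ∧ t 1 < t 0 ∧ t 0 < s} := by
  ext t
  constructor
  · rintro ⟨x, hx, rfl⟩
    have h0 : 0 < s * x 0 := mul_pos hs (hx 0).1
    refine ⟨?_, ?_, ?_⟩
    · rw [hΦ1]
      exact mul_pos h0 (hx 1).1
    · rw [hΦ1, hΦ0]
      exact mul_lt_of_lt_one_right h0 (hx 1).2
    · rw [hΦ0]
      exact mul_lt_of_lt_one_right hs (hx 0).2
  · rintro ⟨h1, h10, h0s⟩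
    have ht0 : 0 < t 0 := h1.trans h10
    refine ⟨![t 0 / s, t 1 / t 0], Fin.forall_fin_two.mpr ⟨?_, ?_⟩, ?_⟩
    · exact ⟨div_pos ht0 hs, (div_lt_one hs).2 h0s⟩
    · exact ⟨div_pos h1 ht0, (div_lt_one ht0).2 h10⟩
    · refine funext (Fin.forall_fin_two.mpr ⟨?_, ?_⟩)
      · rw [hΦ0]
        change s * (t 0 / s) = t 0
        exact mul_div_cancel₀ _ hs.ne'
      · rw [hΦ1]
        change s * (t 0 / s) * (t 1 / t 0) = t 1
        rw [mul_div_cancel₀ _ hs.ne', mul_div_cancel₀ _ ht0.ne']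

/-- For `s < 0` the merge–scale chart maps the open unit box ONTO the open simplex piece
`{s < t₀ < t₁ < 0}` (inverse `t ↦ (t₀/s, t₁/t₀)`). [folklore] -/
theorem bss_image_box_of_neg {s : ℝ} (hs : s < 0) {Φ : (Fin 2 → ℝ) → (Fin 2 → ℝ)}
    (hΦ0 : ∀ x, Φ x 0 = s * x 0) (hΦ1 : ∀ x, Φ x 1 = s * x 0 * x 1) :
    Φ '' {x : Fin 2 → ℝ | ∀ i, x i ∈ Set.Ioo (0:ℝ) 1} = {t | s < t 0 ∧ t 0 < t 1 ∧ t 1 < 0} := by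
  ext t
  constructor
  · rintro ⟨x, hx, rfl⟩
    have h0 : s * x 0 < 0 := mul_neg_of_neg_of_pos hs (hx 0).1
    refine ⟨?_, ?_, ?_⟩
    · rw [hΦ0]
      exact lt_mul_of_lt_one_right hs (hx 0).2
    · rw [hΦ1, hΦ0]
      exact lt_mul_of_lt_one_right h0 (hx 1).2
    · rw [hΦ1]
      exact mul_neg_of_neg_of_pos h0 (hx 1).1
  · rintro ⟨hs0, h01, h1⟩
    have ht0 : t 0 < 0 := h01.trans h1
    refine ⟨![t 0 / s, t 1 / t 0], Fin.forall_fin_two.mpr ⟨?_, ?_⟩, ?_⟩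
    · exact ⟨div_pos_of_neg_of_neg ht0 hs, (div_lt_one_of_neg hs).2 hs0⟩
    · exact ⟨div_pos_of_neg_of_neg h1 ht0, (div_lt_one_of_neg ht0).2 h01⟩
    · refine funext (Fin.forall_fin_two.mpr ⟨?_, ?_⟩)
      · rw [hΦ0]
        change s * (t 0 / s) = t 0
        exact mul_div_cancel₀ _ hs.ne
      · rw [hΦ1]
        change s * (t 0 / s) * (t 1 / t 0) = t 1
        rw [mul_div_cancel₀ _ hs.ne, mul_div_cancel₀ _ ht0.ne]

/-- **The pull-back identity** of the merge–scale chart with factor `z = 1/a` (Jacobian `z² u`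
included): `1/(a − uv) = 1/((z u)(1 − z u v)) · (z² u)` whenever `a z = 1`, `u ≠ 0` and
`a − uv ≠ 0` (then `1 − z u v = z (a − uv) ≠ 0`). [folklore] -/
theorem bss_pullback {a z u v : ℝ} (haz : a * z = 1) (hu : u ≠ 0) (hden : a - u * v ≠ 0) :
    1 / (a - u * v) = 1 / (z * u * (1 - z * u * v)) * (z ^ 2 * u) := by
  have hz : z ≠ 0 := by
    rintro rfl
    simp at haz
  have h1 : 1 - z * u * v = z * (a - u * v) := by linear_combination (-1 : ℝ) * haz
  rw [h1, div_mul_eq_mul_div, one_mul,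
    div_eq_div_iff hden (mul_ne_zero (mul_ne_zero hz hu) (mul_ne_zero hz hden))]
  ring

/-! ## The two rule-(2) moves -/

/-- **Box to simplex, `a ≥ 1`.** For real algebraic `a ≥ 1`, `a z = 1`, and representations `N`
on the open unit box with integrand `1/(a − x₀x₁)` and `A` on `{0 < t₁ < t₀ < z}` with integrand
`1/(t₀(1 − t₁))`: `[N] − [A]` is ONE change-of-variables move of the Kontsevich–Zagier calculus,
along the merge–scale chart `Φ(x) = (z x₀, z x₀x₁)` (`bss_exists_mergeScaleChart` with `s = z`),
whose image of the box is `A.domain` (`bss_image_box_of_pos`) and whose pull-back identity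
`N.integrand x = A.integrand (Φ x) · |det DΦ(x)|` on the box is `bss_pullback`.
[cite: KontsevichZagier2001, §1.2 rule (2)] -/
theorem bss_box_sub_simplex_of_one_le {a z : ℝ} (ha : IsAlgebraic ℚ a) (ha1 : 1 ≤ a)
    (haz : a * z = 1) (N A : IntegralRep 2)
    (hNd : N.domain = {x | ∀ i, x i ∈ Set.Ioo (0:ℝ) 1})
    (hNi : EqOn N.integrand (fun x => 1 / (a - x 0 * x 1)) N.domain)
    (hAd : A.domain = {t | 0 < t 1 ∧ t 1 < t 0 ∧ t 0 < z})
    (hAi : EqOn A.integrand (fun t => 1 / (t 0 * (1 - t 1))) A.domain) :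
    of N - of A ∈ relations := by
  have ha0 : 0 < a := one_pos.trans_le ha1
  have hz : z = a⁻¹ := eq_inv_of_mul_eq_one_right haz
  have hz0 : 0 < z := by rw [hz]; exact inv_pos.2 ha0
  have hza : IsAlgebraic ℚ z := by rw [hz]; exact ha.inv
  obtain ⟨Φ, Φ', hΦ0, hΦ1, hsa, hderiv, hinj, hdet⟩ := bss_exists_mergeScaleChart hza hz0.ne'
  have himage : A.domain = Φ '' N.domain := by rw [hNd, bss_image_box_of_pos hz0 hΦ0 hΦ1, hAd]
  have hsa' : IsSemialgebraicMapOn ℚ N.domain Φ := by rw [hNd]; exact hsa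
  have hinj' : InjOn Φ N.domain := by rw [hNd]; exact hinj
  refine changeOfVariablesRel_subset_relations
    ⟨2, N, A, Φ, Φ', hsa', fun x _ => (hderiv x).hasFDerivWithinAt, hinj', himage,
      fun x hx => ?_, rfl⟩
  -- the pull-back identity on `N.domain`, Jacobian `|det DΦ| = z² x₀` included
  have hΦx : Φ x ∈ A.domain := himage ▸ mem_image_of_mem _ hx
  have hx' : ∀ i, x i ∈ Set.Ioo (0:ℝ) 1 := by rw [hNd] at hx; exact hx
  rw [hNi hx, hAi hΦx, hdet x hx']
  simp only [hΦ0, hΦ1]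
  exact bss_pullback haz (hx' 0).1.ne' (dilogDen_ne_zero (Or.inl ha1) hx')

/-- **Box to simplex, `a < 0`.** For real algebraic `a < 0`, `a w = 1`, and representations `N`
on the open unit box with integrand `1/(a − x₀x₁)` and `A'` on `{w < t₀ < t₁ < 0}` with integrand
`1/(t₀(1 − t₁))`: `[N] − [A']` is ONE change-of-variables move of the Kontsevich–Zagier calculus,
along the merge–scale chart `Φ(x) = (w x₀, w x₀x₁)` (`bss_exists_mergeScaleChart` with `s = w`),
whose image of the box is `A'.domain` (`bss_image_box_of_neg`) and whose pull-back identity on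
the box is `bss_pullback`. [cite: KontsevichZagier2001, §1.2 rule (2)] -/
theorem bss_box_sub_simplex_of_neg {a w : ℝ} (ha : IsAlgebraic ℚ a) (ha1 : a < 0)
    (haw : a * w = 1) (N A' : IntegralRep 2)
    (hNd : N.domain = {x | ∀ i, x i ∈ Set.Ioo (0:ℝ) 1})
    (hNi : EqOn N.integrand (fun x => 1 / (a - x 0 * x 1)) N.domain)
    (hA'd : A'.domain = {t | w < t 0 ∧ t 0 < t 1 ∧ t 1 < 0})
    (hA'i : EqOn A'.integrand (fun t => 1 / (t 0 * (1 - t 1))) A'.domain) :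
    of N - of A' ∈ relations := by
  have hw : w = a⁻¹ := eq_inv_of_mul_eq_one_right haw
  have hw0 : w < 0 := by rw [hw]; exact inv_lt_zero.2 ha1
  have hwa : IsAlgebraic ℚ w := by rw [hw]; exact ha.inv
  obtain ⟨Φ, Φ', hΦ0, hΦ1, hsa, hderiv, hinj, hdet⟩ := bss_exists_mergeScaleChart hwa hw0.ne
  have himage : A'.domain = Φ '' N.domain := by rw [hNd, bss_image_box_of_neg hw0 hΦ0 hΦ1, hA'd]
  have hsa' : IsSemialgebraicMapOn ℚ N.domain Φ := by rw [hNd]; exact hsa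
  have hinj' : InjOn Φ N.domain := by rw [hNd]; exact hinj
  refine changeOfVariablesRel_subset_relations
    ⟨2, N, A', Φ, Φ', hsa', fun x _ => (hderiv x).hasFDerivWithinAt, hinj', himage,
      fun x hx => ?_, rfl⟩
  -- the pull-back identity on `N.domain`, Jacobian `|det DΦ| = w² x₀` included
  have hΦx : Φ x ∈ A'.domain := himage ▸ mem_image_of_mem _ hx
  have hx' : ∀ i, x i ∈ Set.Ioo (0:ℝ) 1 := by rw [hNd] at hx; exact hx
  rw [hNi hx, hA'i hΦx, hdet x hx']
  simp only [hΦ0, hΦ1]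
  exact bss_pullback haw (hx' 0).1.ne' (dilogDen_ne_zero (Or.inr ha1) hx')

/-! ## The registered sub-goal -/

/-- **Stub S3 (`box_sub_simplex`; registered sub-goal of stmt-KontsevichZagierPeriods-3869, line
`SketchIdeator1`, layer `Dilog`).** The merge–scale substitution `(x₀,x₁) ↦ (z x₀, z x₀x₁)`,
`z = 1/a` (rule 2, Jacobian `z² x₀`), identifies the dilogarithm box `[(0,1)², 1/(a − x₀x₁)]`
(value `Li₂(1/a)`) with the simplex piece `[{0 < t₁ < t₀ < z}, 1/(t₀(1 − t₁))]` when `a ≥ 1`,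
and with `[{w < t₀ < t₁ < 0}, 1/(t₀(1 − t₁))]`, `w = 1/a`, when `a < 0` — each as ONE
change-of-variables move of the Kontsevich–Zagier calculus between the given representations.
[cite: KontsevichZagier2001, §1.2 rule (2)] -/
theorem box_sub_simplex :
    (∀ (a z : ℝ), IsAlgebraic ℚ a → 1 ≤ a → a * z = 1 → ∀ (N A : IntegralRep 2),
      N.domain = {x | ∀ i, x i ∈ Set.Ioo (0:ℝ) 1} →
      EqOn N.integrand (fun x => 1 / (a - x 0 * x 1)) N.domain →
      A.domain = {t | 0 < t 1 ∧ t 1 < t 0 ∧ t 0 < z} →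
      EqOn A.integrand (fun t => 1 / (t 0 * (1 - t 1))) A.domain →
      of N - of A ∈ relations) ∧
    (∀ (a w : ℝ), IsAlgebraic ℚ a → a < 0 → a * w = 1 → ∀ (N A' : IntegralRep 2),
      N.domain = {x | ∀ i, x i ∈ Set.Ioo (0:ℝ) 1} →
      EqOn N.integrand (fun x => 1 / (a - x 0 * x 1)) N.domain →
      A'.domain = {t | w < t 0 ∧ t 0 < t 1 ∧ t 1 < 0} →
      EqOn A'.integrand (fun t => 1 / (t 0 * (1 - t 1))) A'.domain →
      of N - of A' ∈ relations) :=
  ⟨fun _ _ ha ha1 haz N A hNd hNi hAd hAi =>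
      bss_box_sub_simplex_of_one_le ha ha1 haz N A hNd hNi hAd hAi,
    fun _ _ ha ha0 haw N A' hNd hNi hA'd hA'i =>
      bss_box_sub_simplex_of_neg ha ha0 haw N A' hNd hNi hA'd hA'i⟩

end Summit.KontsevichZagierPeriods.HurwitzMicroSectors.NormalFormPrinciple.PiBox.Dilog
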